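import Summits.PneNP.PneNP.Theses.SymmetryBudget
import Literature.Computability.Complexity.SymmetricCircuit
import Literature.Computability.Complexity.CircuitComposition
import Literature.Computability.Complexity.CircuitProofs
import Literature.Computability.Complexity.ClayProblemProofs
import Literature.Computability.Complexity.CircuitClassesUniformProofs

/-!
# Line `bbbkv-dialogue` for crux `HamCompiles` (stmt-PneNP-10637, route PneNP/SymmetryBudget)

Crux (definitionally, `hamCompiles_iff`): `NP Bool ⊆ P Bool → ∃ p ∀ m, HasSymCircuit tcBasis
(Bud m ⌊log₂ m⌋) (p m) HAM_m` — poly-size Bud(m,⌊log₂ m⌋)-symmetric threshold circuits for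
Hamiltonicity at every `m`, where Bud fixes the first `m - g` ("ordered") vertices and moves the
last `g = ⌊log₂ m⌋` ("free") ones.

THE LINE (idea card `Ideas/bbbkv-dialogue.md`, triage TRIAGE-r1-{1,2,3}): the ORDERED side
exactly LEARNS the free side.  Every Hamiltonian cycle factors along the ordered/free split into
ordered paths `Q_k` and free paths `P_k`; its junction word `w ∈ (O×O)^t` (`t ≤ g`) records the
ordered endpoints around each free path, and `HAM(x) ⟺ ∃ w, OFeas_x(w) ∧ f_x(w) > 0` where
`f_x(w) = juncCount` counts the tuples of free paths compatible with `w` (stub 1).  `f_x` is a word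
function of a `2^g ≤ m`-state weighted automaton (states = subsets of the free part), hence of
Hankel rank `≤ m`; the ordered side learns an integer SIGN-REPRESENTATION of it by the
Beimel–Bergadano–Bshouty–Kushilevitz–Varricchio multiplicity-automaton learner (stub 3), talking
to the free side only through RESTRICTED-SUM oracles `u ↦ Σ_{w ⊒ u} f_x(w)·R_w` at a hard-wired
evaluation `R` (advice; the crux is non-uniform in `m`), each oracle call being a copy of ONE
parameter-symmetric counting Held–Karp block (stub 2); a `T`-round dialogue of invariant-wire
step circuits with parameter-symmetric oracle blocks is itself a Bud-symmetric circuit (stub 4);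
and the hypothesis `NP ⊆ P` is used ONCE, at the end, to decide the NP predicate
`∃ w, OFeas_x(w) ∧ L·M_w·G > 0` on explicit invariant data (stub 5, the transfer).

Registered stubs (signatures `Sig.stub_*`, obligations `theorem stub_* : Sig.stub_* := by sorry`):
* `stub_junctionAutomaton` — factorisation `HAM = juncPred` (m ≥ 4), linear representation of
  dimension `2^g`, support `≤ g`, value bound `2^m`  (shared with line hankel-forward-kernel);
* `stub_oracleBlocks` — parameter-symmetric poly-size `tcBasis` blocks computing every bit of the
  restricted sums of `juncCount` at a hard-wired `R`, the query word sitting one-hot on wires;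
* `stub_bbbkvLearner` — HARDEST: exact learning of bounded word functions of linear-representation
  dimension `≤ n` from restricted-sum oracles by a poly-size DIALOGUE (step maps with `CktSize`
  bounds, hard-wired separating evaluation `R` found by Schwartz–Zippel + union bound over the
  `2^N`-size target family), ending with an integer sign-representation on invariant wires;
* `stub_dialogueCompile` — generic: invariant-wire step circuits + parameter-symmetric oracle
  blocks ⟹ one `Γ`-symmetric circuit per final-state bit, size `(T+1)(2s + |A|·s_O + 1)`;
* `stub_transfer` — `SignKernel → NP ⊆ P/poly → poly-size Bud-symmetric circuits for juncPred (m ≥ 4)`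
  (the crux's `NP ⊆ P` is bridged to `NP ⊆ P/poly` in the composition by the PROVED tree facts
  `NP_bool_eq_holds`, `P_bool_eq_holds`, `P_subset_PPoly_holds` — Disproof §11's `HamCompilesPPoly` form).
Composition (sorry-free): `signKernel_of_dialogue` (stubs 1–4 ⟹ `SignKernel`), `concl_of_four`
(corners `m ≤ 3`: trivial budget, any circuit), `HamCompiles_of` (the crux BY NAME).

Disproof used (`Cruxes/HamCompiles/Disproof.lean` v4, §0–§11, re-read 2026-08-16T02:15Z): §1 `NPsubP` is
load-bearing — honoured: used exactly once, in `stub_transfer`; §3/§6 — like every compilation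
line this one proves the NON-UNIFORM strengthening (only `NP ⊆ P/poly` on invariant wires is
used), so on landing `WindowHam ↔ HamHardIO` (accepted, recorded in the line card); §4–§5/§7 —
padding and corners are re-proved below (`exists_poly_cover`, `bud_log_eq_of_le_three`,
`concl_of_four`) so that this file does not import the living workfile; no `_false_without_`
theorem and no landed `Negative/` lemma is instantiated by any stub (the Negative lemmas
`Irrefutable`, `NonuniformCollapse` are logical positions, not refuted instances); §9 (budget
scale) is orthogonal; §10 refutes the naive `g!`-symmetrisation STRATEGY — not used here (no stub
lays out Bud-copies of anything); §11's `HamCompilesPPoly` is exactly what `stub_transfer` +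
`npsubPPoly_of_NPsubP` establish.
-/

set_option linter.dupNamespace false
set_option autoImplicit false

namespace Summit.PneNP.PneNP.Cruxes.HamCompiles.BbbkvDialogue

open Literature.Computability.Complexity
open Summit.PneNP.PneNP.Theses.SymmetryBudget (HamCompiles)

/-! ## §0 Vocabulary (the route's inline `let`s, named; `hamCompiles_iff` is `Iff.rfl`) -/

/-- `Bud(m,g)`: the route's symmetry budget (permutations fixing every `i` with `i + g < m`). -/
abbrev Bud (m g : ℕ) : Set (Equiv.Perm (Fin m)) := pointStabiliserBudget m g

/-- The window `g(m) = ⌊log₂ m⌋`. -/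
abbrev gOf (m : ℕ) : ℕ := Nat.log 2 m

open scoped Classical in
/-- `HAM_m`: the route's target `x ↦ [Gr m x is Hamiltonian]` (verbatim the route's lambda). -/
noncomputable def hamFn (m : ℕ) : (Fin m × Fin m → Bool) → Bool :=
  fun x : Fin m × Fin m → Bool =>
    decide (SimpleGraph.fromRel fun u v => x (u, v) = true : SimpleGraph (Fin m)).IsHamiltonian

/-- The bare conclusion of the crux. -/
def Concl : Prop :=
  ∃ p : Polynomial ℕ, ∀ m : ℕ, HasSymCircuit tcBasis (Bud m (gOf m)) (p.eval m) (hamFn m)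

/-- Cook's hypothesis of the crux. -/
def NPsubP : Prop := PNPWave0.NP Bool ⊆ PNPWave0.P Bool

/-- The crux unfolds, definitionally, to `NPsubP → Concl`. -/
theorem hamCompiles_iff : HamCompiles ↔ (NPsubP → Concl) := Iff.rfl

/-- `NP ⊆ P/poly` over the tree's Mathlib-TM2 classes (the form in which every compilation line uses the
hypothesis; Disproof §11 `NPsubPPoly`). -/
def NPsubPPoly : Prop := Nondeterministic.NP ⊆ PPoly

/-- `NP ⊆ P → NP ⊆ P/poly` through the PROVED tree facts `NP_bool_eq_holds`, `P_bool_eq_holds` (model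
bridges Cook ↔ Mathlib-TM2 classes) and `P_subset_PPoly_holds` (Arora–Barak Thm 6.6); verbatim Disproof
§11 `npsubPPoly_of_NPsubP`. This is the only place the crux's hypothesis is touched. -/
theorem npsubPPoly_of_NPsubP (h : NPsubP) : NPsubPPoly := by
  intro L hL
  have hNP : L ∈ PNPWave0.NP Bool := by
    rw [show PNPWave0.NP Bool = Nondeterministic.NP from NP_bool_eq_holds]; exact hL
  have hP : L ∈ PNPWave0.P Bool := h hNP
  rw [show PNPWave0.P Bool = Classes.P from P_bool_eq_holds] at hP
  exact P_subset_PPoly_holds hP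

/-! ## §1 The junction factorisation: vocabulary -/

/-- The graph read off a Boolean matrix (symmetrised, loops dropped — the route's `Gr`). -/
def Gr (m : ℕ) (x : Fin m × Fin m → Bool) : SimpleGraph (Fin m) :=
  SimpleGraph.fromRel fun u v => x (u, v) = true

/-- ORDERED vertices: the first `m - g` (each fixed by every `ρ ∈ Bud m g`). The others are FREE. -/
abbrev IsOrd (m : ℕ) (v : Fin m) : Prop := (v : ℕ) + gOf m < m

/-- The junction alphabet: ordered pairs of ORDERED vertices (`|OPair m| ≤ m²`). Every `ρ ∈ Bud`
fixes every letter — this is what makes letter-indexed gates and one-hot letter wires legal in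
a Bud-symmetric circuit. -/
abbrev OPair (m : ℕ) : Type := {p : Fin m × Fin m // IsOrd m p.1 ∧ IsOrd m p.2}

/-- A directed path of `G`, listed by its vertices: nonempty, no repeated vertex, consecutive
vertices adjacent (a single vertex is a path). -/
def IsDirPath {m : ℕ} (G : SimpleGraph (Fin m)) (l : List (Fin m)) : Prop :=
  l ≠ [] ∧ l.Nodup ∧ l.IsChain G.Adj

/-- F-SIDE of a junction word `w = (o_k, o'_k)_k`: a tuple of directed paths `P_k` in the free part,
one per letter, partitioning the free vertices, with `head P_k ∼ o_k` and `last P_k ∼ o'_k`. -/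
def IsFreeCover (m : ℕ) (x : Fin m × Fin m → Bool) (w : List (OPair m))
    (P : Fin w.length → List (Fin m)) : Prop :=
  (∀ k, IsDirPath (Gr m x) (P k) ∧ ∀ v ∈ P k, ¬ IsOrd m v) ∧
  (∀ v : Fin m, ¬ IsOrd m v → ∃! k, v ∈ P k) ∧
  ∀ k, ∃ a b : Fin m, (P k).head? = some a ∧ (P k).getLast? = some b ∧
    (Gr m x).Adj (w.get k).1.1 a ∧ (Gr m x).Adj b (w.get k).1.2

/-- `juncCount m x w` = the number of F-side realisations of the junction word `w` (the word
function `f_x` of the line; `0` on words longer than `g`, at most `g!·2^(g-1) ≤ 2^m`). -/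
noncomputable def juncCount (m : ℕ) (x : Fin m × Fin m → Bool) (w : List (OPair m)) : ℕ :=
  Set.ncard {P : Fin w.length → List (Fin m) | IsFreeCover m x w P}

/-- O-SIDE feasibility of `w`: directed paths `Q_k` in the ordered part partitioning it, `Q_k`
ending at `o_k` and `Q_{k+1 (mod t)}` starting at `o'_k` (the cycle is `Q₀ P₀ Q₁ P₁ ⋯ Q_{t-1} P_{t-1}`).
An NP predicate of the ORDERED entries of `x` and `w` only. -/
def OFeas (m : ℕ) (x : Fin m × Fin m → Bool) (w : List (OPair m)) : Prop :=
  ∃ Q : Fin w.length → List (Fin m),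
    (∀ k, IsDirPath (Gr m x) (Q k) ∧ ∀ v ∈ Q k, IsOrd m v) ∧
    (∀ v : Fin m, IsOrd m v → ∃! k, v ∈ Q k) ∧
    ∀ k, (Q k).getLast? = some (w.get k).1.1 ∧
      (Q (finRotate w.length k)).head? = some (w.get k).1.2

open scoped Classical in
/-- The factorised Hamiltonicity predicate: some junction word of length `1 ≤ t ≤ g` is feasible
on the ordered side and realisable on the free side. Equals `hamFn m` for `m ≥ 4` (stub 1). -/
noncomputable def juncPred (m : ℕ) (x : Fin m × Fin m → Bool) : Bool :=
  decide (∃ w : List (OPair m), 0 < w.length ∧ w.length ≤ gOf m ∧ OFeas m x w ∧ 0 < juncCount m x w)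

/-! ## §2 Word functions: linear representations, restricted sums, codes, sign-representations -/

/-- `f` has a (rational) linear representation of dimension `n`: `f(w) = α · μ(w₁)⋯μ(w_t) · γ`
(a multiplicity automaton with `n` states; Hankel rank `≤ n` follows, Carlyle–Paz / Fliess). -/
def HasLinRep {Λ : Type} (f : List Λ → ℕ) (n : ℕ) : Prop :=
  ∃ (α γ : Fin n → ℚ) (μ : Λ → Matrix (Fin n) (Fin n) ℚ),
    ∀ w : List Λ, (f w : ℚ) = dotProduct α ((w.map μ).prod.mulVec γ)

/-- All words of length `≤ ℓ` over a finite alphabet. -/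
def wordsLE (Λ : Type) [Fintype Λ] [DecidableEq Λ] (ℓ : ℕ) : Finset (List Λ) :=
  (Finset.range (ℓ + 1)).biUnion fun k => (Finset.univ : Finset (Fin k → Λ)).image List.ofFn

/-- RESTRICTED SUM of `f` at the prefix `u`, at the evaluation `R` (one `d × d` integer matrix per
letter): `Σ_{w ∈ wordsLE Λ ℓ, u <+: w} f(w) • R_{w₁} ⋯ R_{w_|w|}`.  The only oracle of the line:
`u = []` is the equivalence test value, the children `u·σ` drive counterexample descent, and
`f(u)·R_u = rsum u - Σ_σ rsum (u·σ)` recovers values. -/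
def rsum {Λ : Type} [Fintype Λ] [DecidableEq Λ] (ℓ : ℕ) {d : ℕ} (f : List Λ → ℕ)
    (R : Λ → Matrix (Fin d) (Fin d) ℤ) (u : List Λ) : Matrix (Fin d) (Fin d) ℤ :=
  ∑ w ∈ (wordsLE Λ ℓ).filter (fun w => u <+: w), (f w : ℤ) • (w.map R).prod

/-- Sign–magnitude code of an integer at width `W`: bits `j < W` are the binary digits of `|z|`,
bit `W` is `[z < 0]`. Faithful when `|z| < 2^W`. -/
def intBit (W : ℕ) (z : ℤ) (j : Fin (W + 1)) : Bool :=
  if (j : ℕ) < W then z.natAbs.testBit j else decide (z < 0)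

/-- The oracle ANSWER to the query `u`: every entry of `rsum ℓ f R u`, sign–magnitude coded at
width `W`, on the answer wires `Fin d × Fin d × Fin (W + 1)`. -/
def rsumBits {Λ : Type} [Fintype Λ] [DecidableEq Λ] (ℓ d W : ℕ) (f : List Λ → ℕ)
    (R : Λ → Matrix (Fin d) (Fin d) ℤ) (u : List Λ) : Fin d × Fin d × Fin (W + 1) → Bool :=
  fun ijb => intBit W (rsum ℓ f R u ijb.1 ijb.2.1) ijb.2.2

/-- The oracle QUERY `u` (a word of length `≤ ℓ`) one-hot on the query wires
`(Fin ℓ × Λ) ⊕ Fin (ℓ + 1)`: wire `(i, σ)` reads "letter `i` is `σ`", wire `t` reads "the length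
is `t`". (Blocks must answer correctly on these codes only; on other wire patterns anything.) -/
def encodeWord {Λ : Type} [DecidableEq Λ] (ℓ : ℕ) (u : List Λ) : (Fin ℓ × Λ) ⊕ Fin (ℓ + 1) → Bool
  | Sum.inl iσ => decide (u[(iσ.1 : ℕ)]? = some iσ.2)
  | Sum.inr t => decide (u.length = (t : ℕ))

/-- Index set of an integer SIGN-REPRESENTATION of dimension `n` over the alphabet `Λ`: an initial
vector `L`, one `n × n` matrix `M_σ` per letter, a final vector `G`. -/
abbrev KIdx (Λ : Type) (n : ℕ) : Type := Fin n ⊕ (Λ × Fin n × Fin n) ⊕ Fin n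

/-- `srEval κ w = L · M_{w₁} ⋯ M_{w_t} · G` for the sign-representation `κ`. -/
def srEval {Λ : Type} {n : ℕ} (κ : KIdx Λ n → ℤ) (w : List Λ) : ℤ :=
  dotProduct (fun i => κ (Sum.inl i))
    ((w.map fun σ => Matrix.of fun i j => κ (Sum.inr (Sum.inl (σ, i, j)))).prod.mulVec
      fun j => κ (Sum.inr (Sum.inr j)))

/-! ## §3 Dialogues and parameter-symmetric blocks -/

/-- The state of a dialogue after `k` rounds: `state₀ =` all-false; in round `k` the query map
`q k` reads the state and writes the query wires, the oracle answers, and the update map `u k`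
computes the next state from (state, answer). All three live on INVARIANT wires. -/
def dialogueState {S : ℕ} {P A : Type} (q : ℕ → (Fin S → Bool) → P → Bool)
    (u : ℕ → (Fin S ⊕ A → Bool) → Fin S → Bool) (Ans : (P → Bool) → A → Bool) :
    ℕ → Fin S → Bool
  | 0 => fun _ => false
  | k + 1 => u k (Sum.elim (dialogueState q u Ans k) (Ans (q k (dialogueState q u Ans k))))

/-- The diagonal action of `ρ ∈ Γ` on the matrix wires, extended by the identity on the parameter
wires `P` (parameters are invariant data: every automorphism must fix them). -/
def paramMaps {m : ℕ} (Γ : Set (Equiv.Perm (Fin m))) (P : Type) :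
    Set (Equiv.Perm ((Fin m × Fin m) ⊕ P)) :=
  {π | ∃ ρ ∈ Γ, π = Equiv.sumCongr (Equiv.prodCongr ρ ρ) (Equiv.refl P)}

/-- `PBlock m Γ P s F`: a PARAMETER-SYMMETRIC block — a `tcBasis` circuit of size `≤ s` on the
wires (matrix ⊕ parameters), symmetric under `paramMaps Γ P` (Dawar–Wilsenach `Γ`-symmetry in the
variable form `Circuit.IsVarSymmetric`), computing `F`. -/
def PBlock (m : ℕ) (Γ : Set (Equiv.Perm (Fin m))) (P : Type) (s : ℕ)
    (F : ((Fin m × Fin m) ⊕ P → Bool) → Bool) : Prop :=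
  ∃ C : Circuit ((Fin m × Fin m) ⊕ P),
    C.IsOver tcBasis ∧ C.size ≤ s ∧ C.IsVarSymmetric (paramMaps Γ P) ∧ C.Computes F

/-- **The learned kernel** (transfer target `C⁺`, hypothesis-free): for every `m ≥ 4` an integer
sign-representation `κ(x)` of dimension `n ≤ q(m)` and width `W ≤ q(m)` over the junction
alphabet such that `[juncCount m x w > 0] = [srEval (κ x) w > 0]` for all words of length `≤ g`,
EVERY BIT of which is computed by a Bud(m,g)-symmetric threshold circuit of size `≤ q(m)`. -/
def SignKernel : Prop :=
  ∃ q : Polynomial ℕ, ∀ m : ℕ, 4 ≤ m → ∃ n W : ℕ, n ≤ q.eval m ∧ W ≤ q.eval m ∧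
    ∃ κ : (Fin m × Fin m → Bool) → KIdx (OPair m) n → ℤ,
      (∀ x i, |κ x i| < 2 ^ W) ∧
      (∀ x (w : List (OPair m)), w.length ≤ gOf m → (0 < juncCount m x w ↔ 0 < srEval (κ x) w)) ∧
      ∀ i (b : Fin (W + 1)),
        HasSymCircuit tcBasis (Bud m (gOf m)) (q.eval m) (fun x => intBit W (κ x i) b)

/-! ## §4 The five registered stubs

Each stub's statement is the `Prop` `Sig.stub_<name>` (its SIGNATURE); the registered obligation
is `theorem stub_<name> : Sig.stub_<name> := by sorry`; `HamCompiles_of` takes the five signatures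
as hypotheses BY NAME. -/

/-- STUB 1 — JUNCTION FACTORISATION AND THE SUBSET AUTOMATON (size L; finite combinatorics;
shared with line hankel-forward-kernel's `junction_factorisation`). For `m ≥ 4` (so `g ≥ 2`
free and `m - g ≥ 2` ordered vertices): (a) `HAM_m = juncPred m` — cut a Hamiltonian cycle into
maximal ordered/free runs, conversely glue the runs `Q₀ P₀ ⋯ Q_{t-1} P_{t-1}` into a Hamiltonian
cycle (length `m ≥ 4 ≥ 3`); (b) `juncCount m x` has a linear representation of dimension `2^g`:
states = subsets `S` of the free part, `α = e_∅`, `γ = e_F`,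
`μ(o,o')[S,S'] = [S ⊂ S'] · #{directed Hamiltonian paths of Gr[S' \ S] from N(o) to N(o')}`
(transport `Finset F ≃ Fin (2^g)`); (c) support: `t` nonempty paths partition `g` vertices, so
`t ≤ g`; (d) `juncCount ≤ g!·2^(g-1) ≤ 2^m`. Toy-verified three times independently (triage
r1-1/2/3: 0 mismatches of the factorisation `J`/`C` on > 100 000 graphs).
Why it might fail: only by mis-statement (orientation of the cyclic junction convention
`w_k = (last Q_k, head Q_{k+1})`, the `t = 1` / singleton-path corners) — all checked on paper. -/
def Sig.stub_junctionAutomaton : Prop :=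
  ∀ m : ℕ, 4 ≤ m →
    (∀ x, hamFn m x = juncPred m x) ∧
    (∀ x, HasLinRep (juncCount m x) (2 ^ gOf m)) ∧
    (∀ x (w : List (OPair m)), gOf m < w.length → juncCount m x w = 0) ∧
    (∀ x (w : List (OPair m)), juncCount m x w ≤ 2 ^ m)

/-- STUB 2 — PARAMETER-SYMMETRIC RESTRICTED-SUM BLOCKS (size L–XL; the symmetric-circuit
engineering of the line). For `m ≥ 4`, any dimension `d`, width `W`, entry bound `E` and any
hard-wired evaluation `R : OPair m → ℤ^{d×d}` with `|R| < 2^E`: there is a total answer map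
`Ans` agreeing with `rsumBits g d W (juncCount m x) R u` on the one-hot code of every word `u` of
length `≤ g`, every answer bit of which is computed by a `Bud(m,g)`-parameter-symmetric `tcBasis`
block of size `≤ Pq(N)` (`N ≥ m, d, W, E`). Construction: the transfer-matrix DP over SUBSETS of
the free part — gates indexed by (subset `S`, free vertex, letter, DP layer, bit); Hamiltonian-path
counts `hp(D,σ)` by Held–Karp inside `D`; the prefix `u` enters through AND with its one-hot wires
`[u_k = σ]` (letters are ORDERED pairs, fixed by Bud); orbit-indexed sums of numbers (over
`v' ∈ D`, over `S' ⊂ S`) are bit-sliced COUNTS by `MAJ`/threshold gates over the Stab-permuted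
multiset of wires (symmetric gate functions; exactly the aggregation pattern of the symmetric DNF's
`∨` gate, Disproof §7 `dnfDAG_isAut`), then fixed binary arithmetic on wires indexed by the same
orbit data; products with the constant matrices `R_σ` and the final `Σ_S A_u[S]·R_u·B[S]` are
fixed integer arithmetic (`CircuitAdderMultiplier.lean`). Build it as a `GateDAG`
(`CircuitDAG.lean`) and discharge symmetry by `isSymmetricUnder_compile_iff`-style transfer for
`IsVarSymmetric`. Size `2^g · 2^g · poly(m,d,W,E) = poly`.
Why it might fail: an aggregation step that is not index-equivariant (the triage's warning on
gate-local elimination) — here every cross-orbit operation is a symmetric COUNT, no sorting or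
elimination is needed; signed summands (negative `R` entries) are split into positive and negative
parts before counting. -/
def Sig.stub_oracleBlocks : Prop :=
  ∃ Pq : Polynomial ℕ, ∀ (m d W E N : ℕ) (R : OPair m → Matrix (Fin d) (Fin d) ℤ),
    4 ≤ m → m ≤ N → d ≤ N → W ≤ N → E ≤ N → (∀ σ i j, |R σ i j| < 2 ^ E) →
    ∃ Ans : (Fin m × Fin m → Bool) → ((Fin (gOf m) × OPair m) ⊕ Fin (gOf m + 1) → Bool) →
        Fin d × Fin d × Fin (W + 1) → Bool,
      (∀ x (u : List (OPair m)), u.length ≤ gOf m →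
          Ans x (encodeWord (gOf m) u) = rsumBits (gOf m) d W (juncCount m x) R u) ∧
      ∀ r, PBlock m (Bud m (gOf m)) ((Fin (gOf m) × OPair m) ⊕ Fin (gOf m + 1)) (Pq.eval N)
        (fun xp => Ans (fun v => xp (Sum.inl v)) (fun p => xp (Sum.inr p)) r)

/-- STUB 3 — THE BBBKV DIALOGUE IN CIRCUIT FORM (HARDEST; size XL: Beimel–Bergadano–Bshouty–
Kushilevitz–Varricchio, J. ACM 47 (2000), Thm. "multiplicity automata are learnable from
membership and equivalence queries", re-proved and laid out as circuits). Given a finite alphabet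
`Λ`, a length bound `ℓ`, a dimension bound `n`, a value bound `V ≤ 2^N` and a family of at most
`2^N` target word functions `fam ξ : List Λ → ℕ`, each supported on words of length `≤ ℓ`, bounded
by `V` and of linear-representation dimension `n`: there are a hard-wired evaluation
`R : Λ → ℤ^{d×d}` and a dialogue — `T` rounds of query maps `q k` and update maps `u k` with
`tcBasis` circuits of size `≤ s`, all of `d, W, T, S, s ≤ Pb(N)` — which, run against ANY oracle
answering the one-hot code of each word `v` (`|v| ≤ ℓ`) with `rsumBits ℓ d W (fam ξ) R v`, ends
with designated state bits `outIx` holding an integer sign-representation `κ` of dimension `n`,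
`|κ| < 2^W`, with `[fam ξ w > 0] = [srEval κ w > 0]` for all `|w| ≤ ℓ`.
Proof plan: (i) FIRST LEMMA `separating_evaluation` (M): with `d = ℓ+1` and weighted shift
matrices `R_σ = Σ_k t_{σ,k} E_{k,k+1}`, the `(0,|w|)` entry of `R_w` is the monomial
`∏ t_{w_i,i}`, so `D ↦ Σ_w D(w) R_w` is injective on functions of words `≤ ℓ`; by
`MvPolynomial.schwartz_zippel_totalDegree` some `t ∈ {1,…,|𝓓|·ℓ+1}^{Λ×ℓ}` separates every member
of a finite family `𝓓` of nonzero differences — take `𝓓 = {fam ξ - h}` over the `2^N` targets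
and the `2^{poly(N)}` BBBKV hypotheses `h = h(ξ, X, Y)` (prefix/suffix sets of size `≤ n`; entries
ratios of minors, `≤ n!·V^n`), so `W = poly(N)`; (ii) BBBKV proper: values by
`f(u)·R_u = rsum u - Σ_σ rsum (uσ)` (`R` positive, so `R_u ≠ 0`), equivalence by comparing
`rsum [] = Σ_w f(w) R_w` with `Σ_w h(w) R_w` (sound by (i)), counterexamples by prefix descent
(`T_u ≠ T_u(h)` ⇒ own term or a child differs; depth `≤ ℓ`), `≤ n + 1` equivalence rounds since
each counterexample raises the rank of the Hankel block `X × Y` and `rank ≤ n`; (iii) output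
`κ = (e₁, sign(det Ĥ)·Ĥ_σ·adj Ĥ, γ)` padded to dimension `n` (sign of `h(w)` preserved);
(iv) circuits for the step maps: exact integer/rational arithmetic of `poly(N)` bits by the tree's
adders/multipliers on INVARIANT wires (no symmetry constraint there), `T = poly(N)` oracle calls.
Why it might fail: not mathematically (BBBKV is a theorem and the advice exists by counting); the
risk is size of the formalisation (Cramer/adjugate circuits, the learner's control flow as
straight-line step maps). No hypothesis `NP ⊆ P` is used: the learner is deterministic on explicit
data (triage r1-2's correction of the card is adopted). -/
def Sig.stub_bbbkvLearner : Prop :=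
  ∃ Pb : Polynomial ℕ, ∀ (Λ : Type) [Fintype Λ] [DecidableEq Λ] (X : Type) [Fintype X]
    (ℓ n V N : ℕ) (fam : X → List Λ → ℕ),
    Fintype.card Λ ≤ N → ℓ ≤ N → n ≤ N → V ≤ 2 ^ N → Fintype.card X ≤ 2 ^ N →
    (∀ ξ, HasLinRep (fam ξ) n ∧ (∀ w, fam ξ w ≤ V) ∧ ∀ w : List Λ, ℓ < w.length → fam ξ w = 0) →
    ∃ (d W T S s : ℕ) (R : Λ → Matrix (Fin d) (Fin d) ℤ)
      (q : ℕ → (Fin S → Bool) → (Fin ℓ × Λ) ⊕ Fin (ℓ + 1) → Bool)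
      (u : ℕ → (Fin S ⊕ (Fin d × Fin d × Fin (W + 1)) → Bool) → Fin S → Bool)
      (outIx : KIdx Λ n × Fin (W + 1) → Fin S),
      d ≤ Pb.eval N ∧ W ≤ Pb.eval N ∧ T ≤ Pb.eval N ∧ S ≤ Pb.eval N ∧ s ≤ Pb.eval N ∧
      (∀ σ i j, |R σ i j| < 2 ^ W) ∧
      (∀ k, CktSize tcBasis (q k) s ∧ CktSize tcBasis (u k) s) ∧
      ∀ ξ (Ans : ((Fin ℓ × Λ) ⊕ Fin (ℓ + 1) → Bool) → Fin d × Fin d × Fin (W + 1) → Bool),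
        (∀ v : List Λ, v.length ≤ ℓ → Ans (encodeWord ℓ v) = rsumBits ℓ d W (fam ξ) R v) →
        ∃ κ : KIdx Λ n → ℤ, (∀ i, |κ i| < 2 ^ W) ∧
          (∀ i b, dialogueState q u Ans T (outIx (i, b)) = intBit W (κ i) b) ∧
          ∀ w : List Λ, w.length ≤ ℓ → (0 < fam ξ w ↔ 0 < srEval κ w)

/-- STUB 4 — COMPILING A DIALOGUE INTO ONE SYMMETRIC CIRCUIT (size M; straight-line plumbing over
`CircuitComposition.lean` / `CircuitPlug.lean`: `reloc`, `vals_append_reloc`). Lay out: one `∨₀`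
gate (the all-false initial state), then per round the query circuit (inputs re-wired to the
state wires), one copy of the oracle block per answer bit `r : A` (matrix inputs to the matrix
wires, parameter inputs to the query wires) and the update circuit. For `ρ ∈ Γ` the automorphism
is the identity on every step-map gate and, inside each block copy, the block's own automorphism
over `ρ×ρ ⊕ id` (`IsVarSymmetric (paramMaps Γ P)`), which fixes the block's parameter and output
wires — so every state/query/answer wire is fixed and the argument multisets correspond
(adaptivity is free in a circuit: query bits are gates). Size `≤ 1 + T·(2s + |A|·s_O)`.
Why it might fail: only bookkeeping (offsets under `reloc`); the bound has slack `(T+1)(…+1)`. -/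
def Sig.stub_dialogueCompile : Prop :=
  ∀ (m : ℕ) (Γ : Set (Equiv.Perm (Fin m))) (P A : Type) [Fintype A] (S T s sO : ℕ)
    (q : ℕ → (Fin S → Bool) → P → Bool) (u : ℕ → (Fin S ⊕ A → Bool) → Fin S → Bool)
    (Ans : (Fin m × Fin m → Bool) → (P → Bool) → A → Bool),
    (∀ k, CktSize tcBasis (q k) s ∧ CktSize tcBasis (u k) s) →
    (∀ r : A, PBlock m Γ P sO (fun xp => Ans (fun v => xp (Sum.inl v)) (fun p => xp (Sum.inr p)) r)) →
    ∀ i : Fin S, HasSymCircuit tcBasis Γ ((T + 1) * (s + s + Fintype.card A * sO + 1))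
      (fun x => dialogueState q u (Ans x) T i)

/-- STUB 5 — TRANSFER: THE ORDERED SIDE DECIDES (size L; the ONLY use of the hypothesis, in its
`NP ⊆ P/poly` form `NPsubPPoly` — so the line proves Disproof §11's `HamCompilesPPoly` / §3's
non-uniform strengthening and accepts §6 `WindowHam ↔ HamHardIO`). From `SignKernel`: the language
`L = {⟨1^m 0, n, W, x|_{O×O}, bits of κ⟩ : ∃ w ∈ (OPair m)^{1..g}, OFeas_x(w) ∧ srEval κ w > 0}`
is in `Nondeterministic.NP` (verifier guesses `w` and the ordered paths `Q`; `OFeas` reads only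
ordered entries; `srEval` is integer matrix arithmetic — pattern `HAMCIRCUIT_mem_NP` /
`npLang_mem_NP` / `inter_P_mem_polyExists`); `NP ⊆ P/poly` gives poly-size `B₂` circuit families
deciding `L` (`PPoly`, `SIZE`, `CircuitFamily.Decides`); at each `m ≥ 4` take the circuit for the
code length `N(m) = poly(m)`, rewrite `B₂ → tcBasis` (≤ 5 gates per gate), feed the constant code
bits by `∧₀/∨₀` gates, the ordered entries `x(o,o')` by their input wires (fixed by `ρ×ρ` for
`ρ ∈ Bud`) and the kernel bits by the Bud-symmetric kernel circuits of `SignKernel`; the composite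
is Bud-symmetric (kernel copies permute internally, everything else is fixed) and computes
`juncPred m` by the sign property of `κ`.
Why it might fail: not at all mathematically; formalisation risk = the TM-level `L ∈ NP`. -/
def Sig.stub_transfer : Prop :=
  SignKernel → NPsubPPoly → ∃ p : Polynomial ℕ, ∀ m : ℕ, 4 ≤ m →
    HasSymCircuit tcBasis (Bud m (gOf m)) (p.eval m) (juncPred m)

/-- Registered stub 1 (junction factorisation + subset automaton). -/
theorem stub_junctionAutomaton : Sig.stub_junctionAutomaton := by
  sorry

/-- Registered stub 2 (parameter-symmetric restricted-sum blocks). -/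
theorem stub_oracleBlocks : Sig.stub_oracleBlocks := by
  sorry

/-- Registered stub 3 (BBBKV dialogue in circuit form — hardest). -/
theorem stub_bbbkvLearner : Sig.stub_bbbkvLearner := by
  sorry

/-- Registered stub 4 (dialogue ⟹ symmetric circuit). -/
theorem stub_dialogueCompile : Sig.stub_dialogueCompile := by
  sorry

/-- Registered stub 5 (transfer: NP ⊆ P/poly decides on the learned kernel). -/
theorem stub_transfer : Sig.stub_transfer := by
  sorry

/-! ## §5 Corners `m ≤ 3` and padding (re-proved after the crux workfile `Disproof.lean` §4–§6,
refuter-cdisprove-stmt-PneNP-10637, so that this file is self-contained) -/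

/-- Padding a polynomial by a constant that covers finitely many exceptional `m`. -/
theorem exists_poly_cover (p : Polynomial ℕ) (M : ℕ) (s : ℕ → ℕ) :
    ∃ p' : Polynomial ℕ, (∀ m, p.eval m ≤ p'.eval m) ∧ ∀ m < M, s m ≤ p'.eval m := by
  refine ⟨p + Polynomial.C (∑ i ∈ Finset.range M, s i), fun m => ?_, fun m hm => ?_⟩
  · simp
  · simp only [Polynomial.eval_add, Polynomial.eval_C]
    exact le_add_left (Finset.single_le_sum (f := s) (fun _ _ => Nat.zero_le _)
      (Finset.mem_range.2 hm))

/-- For `m ≤ 3` the budget `⌊log₂ m⌋ ≤ 1` frees at most one vertex: the group is trivial. -/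
theorem bud_log_eq_of_le_three {m : ℕ} (hm : m ≤ 3) : Bud m (gOf m) = {1} := by
  have hlog : Nat.log 2 m ≤ 1 := by
    interval_cases m <;> decide
  ext ρ
  simp only [Bud, gOf, mem_pointStabiliserBudget_iff, Set.mem_singleton_iff]
  constructor
  · intro h
    refine Equiv.ext fun i => ?_
    show ρ i = i
    by_cases hi : (i : ℕ) + Nat.log 2 m < m
    · exact h i hi
    · by_contra hne
      have hj : ((ρ i : Fin m) : ℕ) + Nat.log 2 m < m := by
        have h1 : ((ρ i : Fin m) : ℕ) ≠ (i : ℕ) := fun e => hne (Fin.ext e)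
        have h2 := (ρ i).2
        have h3 := i.2
        omega
      exact hne (ρ.injective (h (ρ i) hj))
  · rintro rfl i _
    rfl

/-- The arity-0 conjunction is the constant `true` gate. -/
theorem gateFn_const_true_eq : (⟨0, fun _ => true⟩ : GateFn) = GateFn.and 0 := by
  simp only [GateFn.and]
  exact Sigma.ext rfl (heq_of_eq (funext fun v => by simp))

/-- The arity-0 disjunction is the constant `false` gate. -/
theorem gateFn_const_false_eq : (⟨0, fun _ => false⟩ : GateFn) = GateFn.or 0 := by
  simp only [GateFn.or]
  exact Sigma.ext rfl (heq_of_eq (funext fun v => by simp))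

/-- Constant gates are in `tcBasis` (as `∧₀`, `∨₀`). -/
theorem gateFn_const_mem_tcBasis (b : Bool) : (⟨0, fun _ => b⟩ : GateFn) ∈ tcBasis := by
  refine acBasis_subset_tcBasis (Or.inr (Set.mem_iUnion.2 ⟨0, ?_⟩))
  cases b
  · rw [gateFn_const_false_eq]; exact Or.inr rfl
  · rw [gateFn_const_true_eq]; exact Or.inl rfl

/-- `{∧₂, ∨₂, ¬} ⊆ tcBasis`. -/
theorem deMorganBasis_subset_tcBasis : deMorganBasis ⊆ tcBasis := by
  intro f hf
  simp only [deMorganBasis, Set.mem_insert_iff, Set.mem_singleton_iff] at hf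
  refine acBasis_subset_tcBasis ?_
  rcases hf with rfl | rfl | rfl
  · exact Or.inr (Set.mem_iUnion.2 ⟨2, Or.inl rfl⟩)
  · exact Or.inr (Set.mem_iUnion.2 ⟨2, Or.inr rfl⟩)
  · exact Or.inl rfl

/-- Per-`m` existence of SOME threshold circuit for `HAM_m` (constant circuit on the empty matrix,
`exists_computes_deMorgan_holds` otherwise). -/
theorem exists_circuit_hamFn (m : ℕ) : ∃ s : ℕ, ∃ C : Circuit (Fin m × Fin m),
    C.IsOver tcBasis ∧ C.size ≤ s ∧ C.Computes (hamFn m) := by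
  rcases Nat.eq_zero_or_pos m with rfl | hm
  · refine ⟨1, Circuit.const (Fin 0 × Fin 0) (hamFn 0 fun q => q.1.elim0), ?_, le_rfl, fun x => ?_⟩
    · intro g hg
      simp only [Circuit.const, List.mem_singleton] at hg
      subst hg
      exact gateFn_const_mem_tcBasis _
    · rw [Circuit.eval_const]
      congr 1
      funext q
      exact q.1.elim0
  · haveI : Nonempty (Fin m × Fin m) := ⟨(⟨0, hm⟩, ⟨0, hm⟩)⟩
    obtain ⟨C, hB, hf⟩ := exists_computes_deMorgan_holds (hamFn m)
    exact ⟨C.size, C, hB.mono deMorganBasis_subset_tcBasis, le_rfl, hf⟩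

/-- Corners: for `m ≤ 3` the budget is trivial, so any circuit for `HAM_m` is symmetric. -/
theorem hasSymCircuit_small {m : ℕ} (hm : m ≤ 3) :
    ∃ s, HasSymCircuit tcBasis (Bud m (gOf m)) s (hamFn m) := by
  obtain ⟨s, C, hB, hs, hf⟩ := exists_circuit_hamFn m
  refine ⟨s, C, hB, hs, ?_, hf⟩
  rw [bud_log_eq_of_le_three hm]
  exact C.isSymmetricUnder_one

/-- PADDING: circuits of size `p(m)` for every `m ≥ 4` give the conclusion at every `m`. -/
theorem concl_of_four {p : Polynomial ℕ}
    (h4 : ∀ m, 4 ≤ m → HasSymCircuit tcBasis (Bud m (gOf m)) (p.eval m) (hamFn m)) : Concl := by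
  have hsmall : ∀ m, ∃ s, m ≤ 3 → HasSymCircuit tcBasis (Bud m (gOf m)) s (hamFn m) := by
    intro m
    by_cases hm : m ≤ 3
    · obtain ⟨s, hs⟩ := hasSymCircuit_small hm
      exact ⟨s, fun _ => hs⟩
    · exact ⟨0, fun h => absurd h hm⟩
  choose s hs using hsmall
  obtain ⟨p', hpp', hsp'⟩ := exists_poly_cover p 4 s
  refine ⟨p', fun m => ?_⟩
  by_cases hm : m < 4
  · exact (hs m (by omega)).mono (hsp' m hm)
  · exact (h4 m (by omega)).mono (hpp' m)

/-! ## §6 The composition: the five stubs give the crux BY NAME -/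

/-- Stubs 1–4 assemble the learned kernel: targets `juncCount m x` (dimension `2^g`, values
`≤ 2^m`, support `≤ g`; `≤ 2^{m²}` of them) are learned by the dialogue of stub 3 against the
blocks of stub 2 at stub 3's hard-wired `R`, and stub 4 compiles the dialogue into one
Bud-symmetric circuit per kernel bit; all parameters are polynomial in `m`
(`N = (m+1)²`, `N' = N + Pb(N)`). -/
theorem signKernel_of_dialogue (hJ : Sig.stub_junctionAutomaton) (hO : Sig.stub_oracleBlocks)
    (hL : Sig.stub_bbbkvLearner) (hC : Sig.stub_dialogueCompile) : SignKernel := by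
  obtain ⟨Pq, hPq⟩ := hO
  obtain ⟨Pb, hPb⟩ := hL
  let NX : Polynomial ℕ := (Polynomial.X + 1) ^ 2
  let B : Polynomial ℕ := Pb.comp NX
  let Q : Polynomial ℕ := Pq.comp (NX + B)
  have hNX : ∀ m : ℕ, NX.eval m = (m + 1) ^ 2 := fun m => by
    simp [NX]
  have hB : ∀ m : ℕ, B.eval m = Pb.eval ((m + 1) ^ 2) := fun m => by
    simp [B, Polynomial.eval_comp, hNX]
  have hQ : ∀ m : ℕ, Q.eval m = Pq.eval ((m + 1) ^ 2 + Pb.eval ((m + 1) ^ 2)) := fun m => by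
    simp [Q, Polynomial.eval_comp, hNX, hB]
  refine ⟨(B + 1) * (B + B + B * (B * (B + 1)) * Q + 1) + NX + B, fun m hm => ?_⟩
  -- the parameters at size `m`
  have hm0 : m ≠ 0 := by omega
  have h2g : 2 ^ gOf m ≤ m := Nat.pow_log_le_self 2 hm0
  have hgle : gOf m ≤ m := (Nat.lt_two_pow_self).le.trans h2g
  have hN1 : m ≤ (m + 1) ^ 2 := by nlinarith
  have hcardΛ : Fintype.card (OPair m) ≤ (m + 1) ^ 2 :=
    (Fintype.card_subtype_le _).trans (by
      simp only [Fintype.card_prod, Fintype.card_fin]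
      nlinarith)
  have hℓ : gOf m ≤ (m + 1) ^ 2 := hgle.trans hN1
  have hn : 2 ^ gOf m ≤ (m + 1) ^ 2 := h2g.trans hN1
  have hV : 2 ^ m ≤ 2 ^ (m + 1) ^ 2 := Nat.pow_le_pow_right (by norm_num) hN1
  have hX : Fintype.card (Fin m × Fin m → Bool) ≤ 2 ^ (m + 1) ^ 2 := by
    rw [Fintype.card_fun, Fintype.card_bool, Fintype.card_prod, Fintype.card_fin]
    exact Nat.pow_le_pow_right (by norm_num) (by nlinarith)
  have hfam : ∀ x : Fin m × Fin m → Bool, HasLinRep (juncCount m x) (2 ^ gOf m) ∧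
      (∀ w, juncCount m x w ≤ 2 ^ m) ∧
      ∀ w : List (OPair m), gOf m < w.length → juncCount m x w = 0 :=
    fun x => ⟨(hJ m hm).2.1 x, (hJ m hm).2.2.2 x, (hJ m hm).2.2.1 x⟩
  -- the learner (stub 3) on the family `x ↦ juncCount m x`
  obtain ⟨d, W, T, S, s, R, q, u, outIx, hd, hW, hT, hS, hs, hR, hqu, hrun⟩ :=
    hPb (OPair m) (Fin m × Fin m → Bool) (gOf m) (2 ^ gOf m) (2 ^ m) ((m + 1) ^ 2)
      (juncCount m) hcardΛ hℓ hn hV hX hfam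
  -- the oracle blocks (stub 2) at the learner's hard-wired evaluation `R`
  obtain ⟨Ans, hAns, hblk⟩ :=
    hPq m d W W ((m + 1) ^ 2 + Pb.eval ((m + 1) ^ 2)) R hm (by omega) (by omega) (by omega)
      (by omega) hR
  -- compile the dialogue (stub 4)
  have hsym := hC m (Bud m (gOf m)) ((Fin (gOf m) × OPair m) ⊕ Fin (gOf m + 1))
    (Fin d × Fin d × Fin (W + 1)) S T s (Pq.eval ((m + 1) ^ 2 + Pb.eval ((m + 1) ^ 2)))
    q u Ans hqu hblk
  -- the learned sign-representation
  choose κ hκb hκbits hκsign using fun x => hrun x (Ans x) (hAns x)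
  refine ⟨2 ^ gOf m, W, ?_, ?_, κ, hκb, fun x w hw => hκsign x w hw, fun i b => ?_⟩
  · simp only [Polynomial.eval_add, hNX]
    exact (hn.trans (Nat.le_add_left _ _)).trans (Nat.le_add_right _ _)
  · simp only [Polynomial.eval_add, hB]
    exact hW.trans (Nat.le_add_left _ _)
  · have hfun : (fun x => intBit W (κ x i) b) =
        fun x => dialogueState q u (Ans x) T (outIx (i, b)) :=
      funext fun x => (hκbits x i b).symm
    rw [hfun]
    refine (hsym (outIx (i, b))).mono ?_
    have hA : Fintype.card (Fin d × Fin d × Fin (W + 1)) = d * (d * (W + 1)) := by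
      simp only [Fintype.card_prod, Fintype.card_fin]
    rw [hA]
    simp only [Polynomial.eval_add, Polynomial.eval_mul, Polynomial.eval_one, hB, hQ, hNX]
    calc (T + 1) * (s + s + d * (d * (W + 1)) *
            Pq.eval ((m + 1) ^ 2 + Pb.eval ((m + 1) ^ 2)) + 1)
        ≤ (Pb.eval ((m + 1) ^ 2) + 1) * (Pb.eval ((m + 1) ^ 2) + Pb.eval ((m + 1) ^ 2) +
            Pb.eval ((m + 1) ^ 2) * (Pb.eval ((m + 1) ^ 2) * (Pb.eval ((m + 1) ^ 2) + 1)) *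
            Pq.eval ((m + 1) ^ 2 + Pb.eval ((m + 1) ^ 2)) + 1) := by
          gcongr
      _ ≤ _ := (Nat.le_add_right _ _).trans (Nat.le_add_right _ _)

/-- **The line.** Junction factorisation + parameter-symmetric restricted-sum blocks + the BBBKV
dialogue + dialogue compilation + the NP-transfer imply the crux `SymmetryBudget.HamCompiles`:
`NP ⊆ P` is bridged to `NP ⊆ P/poly` (`npsubPPoly_of_NPsubP`, proved tree facts) and enters only
through `stub_transfer`; the corners `m ≤ 3` are padded by `concl_of_four`. -/
theorem HamCompiles_of :
    Sig.stub_junctionAutomaton → Sig.stub_oracleBlocks → Sig.stub_bbbkvLearner →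
      Sig.stub_dialogueCompile → Sig.stub_transfer → HamCompiles := by
  intro hJ hO hL hC hT
  rw [hamCompiles_iff]
  intro hNP
  obtain ⟨p, hp⟩ := hT (signKernel_of_dialogue hJ hO hL hC) (npsubPPoly_of_NPsubP hNP)
  refine concl_of_four (p := p) fun m hm => ?_
  have hfun : hamFn m = juncPred m := funext (hJ m hm).1
  rw [hfun]
  exact hp m hm

/-- The crux modulo the five registered stubs. -/
theorem HamCompiles_proof : HamCompiles :=
  HamCompiles_of stub_junctionAutomaton stub_oracleBlocks stub_bbbkvLearner stub_dialogueCompile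
    stub_transfer

end Summit.PneNP.PneNP.Cruxes.HamCompiles.BbbkvDialogue
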